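import Mathlib
import Literature.Topology.FourManifolds.ProfiniteDetectionSumS1S2
import Literature.Topology.FourManifolds.ProfiniteDetectionSumS1S2Proofs
import Literature.Topology.FourManifolds.KneserMilnorRetract
import Literature.Topology.FourManifolds.AsphericalThreeManifoldGroupNotProjective
import Summits.SmoothPoincare4.SmoothPoincare4.Theses.CongruenceShadows
import Summits.SmoothPoincare4.SmoothPoincare4.Theorems.CongruenceShadowsHeegaardPairFreenessDetectionStubSubsingletonOfIsCyclic
import Summits.SmoothPoincare4.SmoothPoincare4.Theorems.CongruenceShadowsHeegaardPairFreenessDetectionStubLiftOfFiniteIndex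

/-!
# Crux `HeegaardPairFreenessDetection` (stmt-SmoothPoincare4-15157) — the projective-retract sieve,
# conditional on the three named facts of 3-manifold topology

The crux (route `CongruenceShadows`, rank 7; the fact debt of stub P2 of crux
`HeegaardHandlebodyCongruenceClosed`): for `K₁, K₂ ≤ S_g` with `S_g ⧸ ⟪Kᵢ⟫` free of rank `g`, if the
pair quotient `G = S_g ⧸ ⟪K₁ ∪ K₂⟫` has exactly the finite quotients of `F_k`, then `G ≅ F_k`.

Line `Sketch`, composition `projective-retract-sieve` (lead skeleton
`Cruxes/HeegaardPairFreenessDetection/Lines/Sketch.lean`).  ALL GROUP THEORY IS PROVED in the tree: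
"same finite quotients as `F_k`" gives the LIFTING PROPERTY — every homomorphism to a finite group
lifts through every surjection of finite groups (`exists_monoidHom_comp_eq_of_sameFiniteQuotients_freeGroup`,
the finite shadow of "`Ĝ` is projective"); it passes to retracts (`lift_of_retract`) and to
finite-index subgroups (stub S1 `stub_liftOfFiniteIndex`, coinduction to `(G/V → E) ⋊ Sym(G/V)`); a
finite cyclic group with it is trivial (stub S2 `stub_subsingleton_of_isCyclic`, `ℤ/n² ↠ ℤ/n`), hence
so is every finite group with it (`subsingleton_of_finite_of_lift`).  The 3-MANIFOLD TOPOLOGY enters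
through three NAMED FACTS (D-0014), taken as hypotheses BY NAME, which makes the main theorem
`HeegaardPairFreenessDetection_of_facts` a CONDITIONAL result (the item stays open until they are
discharged):

* `Literature.Topology.FourManifolds.exists_closedThreeManifold_fundamentalGroup_pairQuotient` — the
  Jaco–Hempel bridge (Hempel Lemmas 14.4–14.5 = Jaco 1969; Leininger–Reid Lemma 2.2): the pair quotient
  is `π₁(Y, y)` of a closed orientable 3-manifold;
* `Literature.Topology.FourManifolds.kneserMilnor_retract_alternative` — Kneser–Milnor in retract form
  (Kneser 1929 / Milnor 1962, Hempel Thm. 3.15, Lemmas 3.13 and 3.2; Aschenbrenner–Friedl–Wilton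
  Thm. 1.1 and (C.1); Perelman is not used): `π₁(Y, y)` is free of some rank, or retracts onto a
  non-trivial group that is finite or a closed orientable aspherical 3-manifold group;
* `Literature.Topology.FourManifolds.not_lift_fundamentalGroup_of_aspherical` — closed orientable
  aspherical 3-manifold groups lack the lifting property (goodness of 3-manifold groups,
  Aschenbrenner–Friedl–Wilton (G.24)/(H.5) and proof of Prop. 9.29, with Serre I §3.4 Prop. 16 and
  I §5.9 Cor. 2; Perelman + Agol–Wise inside).

Compared with the closure through `isFreeOfRank_fundamentalGroup_of_sameFiniteQuotients`
(Wilton–Zalesskii 2019 Thm. A for `#ᵏ S¹ × S²`, which vendors Kneser–Milnor + profinite Bass–Serre +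
goodness + Perelman as one Prop), the sieve KILLS every Kneser–Milnor factor instead of matching
decompositions, so no profinite trees are needed and the Perelman-dependent input is isolated in the
single fact about aspherical manifolds.
-/

noncomputable section

-- the prescribed namespace `Summit.<P>.<Sub>.…` duplicates `SmoothPoincare4` (P = Sub)
set_option linter.dupNamespace false

namespace Summit.SmoothPoincare4.SmoothPoincare4.Theorems.HeegaardPairFreenessDetection.Sieve

open Literature.Topology.FourManifolds Subgroup
open scoped Manifold ContDiff

universe u v

/-! ## Group theory: no non-trivial finite group has the lifting property -/

/-- **No non-trivial finite group has the lifting property**: for `a ∈ A`, the cyclic subgroup `⟨a⟩`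
has finite index, inherits the lifting property (`stub_liftOfFiniteIndex`) and is therefore trivial
(`stub_subsingleton_of_isCyclic`), so `a = 1`.  (Finite shadow of "projective profinite groups are
torsion-free"; in Wilton–Zalesskii's proof of Thm. 2.2 this is the step excluding Kneser–Milnor
summands with finite fundamental group, there via Cor. 1.13.) [folklore] -/
theorem subsingleton_of_finite_of_lift {A : Type u} [Group A] [Finite A]
    (hA : ∀ (P E : Type) [Group P] [Finite P] [Group E] [Finite E] (π : A →* P) (ε : E →* P),
      Function.Surjective ε → ∃ f : A →* E, ε.comp f = π) : Subsingleton A := by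
  refine subsingleton_of_forall_eq 1 fun a => ?_
  haveI : Subsingleton (zpowers a) :=
    stub_subsingleton_of_isCyclic (stub_liftOfFiniteIndex (zpowers a) hA)
  have h : (⟨a, mem_zpowers a⟩ : zpowers a) = 1 := Subsingleton.elim _ _
  exact congrArg Subtype.val h

/-- **Torsion is invisible in the finite quotients of a group with the lifting property**: an element
of finite order lies in the kernel of every homomorphism to a finite group.  (Pull the cyclic subgroup
generated by the image back to a finite-index subgroup `V ∋ g`, which inherits the lifting property by
`stub_liftOfFiniteIndex`; there `g` dies in every cyclic quotient, `s2_map_eq_one_of_isOfFinOrder_of_lift`.)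
For a residually finite group — e.g. a closed 3-manifold group, given geometrisation — this says the
group is torsion-free. [folklore] -/
theorem map_eq_one_of_isOfFinOrder_of_lift {G : Type u} [Group G]
    (hG : ∀ (P E : Type) [Group P] [Finite P] [Group E] [Finite E] (π : G →* P) (ε : E →* P),
      Function.Surjective ε → ∃ f : G →* E, ε.comp f = π)
    {g : G} (hg : IsOfFinOrder g) {Q : Type*} [Group Q] [Finite Q] (q : G →* Q) : q g = 1 := by
  classical
  -- the finite-index subgroup `V = q⁻¹ ⟨q g⟩`
  let V : Subgroup G := (zpowers (q g)).comap q
  haveI : V.FiniteIndex := by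
    refine @Subgroup.finiteIndex_of_finite_quotient _ _ V ?_
    exact Finite.of_injective (fun x : G ⧸ V => (QuotientGroup.mk (q x.out) : Q ⧸ zpowers (q g)))
      (by
        intro x y hxy
        have hx := QuotientGroup.out_eq' x
        have hy := QuotientGroup.out_eq' y
        rw [← hx, ← hy, QuotientGroup.eq]
        have h := QuotientGroup.eq.1 hxy
        simpa [V, Subgroup.mem_comap, map_mul, map_inv] using h)
  have hgV : g ∈ V := by simp [V, Subgroup.mem_comap]
  -- `V` has the lifting property, and `⟨q g⟩` is finite cyclic
  have hV := stub_liftOfFiniteIndex V hG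
  set n : ℕ := Nat.card (zpowers (q g)) with hn
  haveI : NeZero n := ⟨Nat.card_pos.ne'⟩
  -- `V → ⟨q g⟩ ≅ ℤ/n`
  let e : zpowers (q g) ≃* Multiplicative (ZMod n) :=
    (zmodCyclicMulEquiv (Subgroup.isCyclic_zpowers (q g))).symm
  let φ : V →* Multiplicative (ZMod n) :=
    e.toMonoidHom.comp ((q.comp V.subtype).codRestrict (zpowers (q g)) fun v => v.2)
  have hgV' : IsOfFinOrder (⟨g, hgV⟩ : V) :=
    (Subgroup.subtype_injective V).isOfFinOrder_iff.1 hg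
  have hφ : φ ⟨g, hgV⟩ = 1 := s2_map_eq_one_of_isOfFinOrder_of_lift hV hgV' φ
  -- so `q g`, a generator of `⟨q g⟩`, is trivial
  have h1 : (⟨q g, mem_zpowers (q g)⟩ : zpowers (q g)) = 1 := by
    apply e.injective
    rw [map_one]
    simpa [φ] using hφ
  exact congrArg Subtype.val h1

/-- The lifting property passes to retracts: if `ρ ∘ s = id_B` and `G` lifts, so does `B` (compose the
problem with `ρ`, restrict the solution along `s`). [folklore] -/
theorem lift_of_retract {G : Type u} {B : Type v} [Group G] [Group B] (ρ : G →* B) (s : B →* G)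
    (hρs : ∀ b, ρ (s b) = b)
    (hG : ∀ (P E : Type) [Group P] [Finite P] [Group E] [Finite E] (π : G →* P) (ε : E →* P),
      Function.Surjective ε → ∃ f : G →* E, ε.comp f = π)
    (P E : Type) [Group P] [Finite P] [Group E] [Finite E] (π : B →* P) (ε : E →* P)
    (hε : Function.Surjective ε) : ∃ f : B →* E, ε.comp f = π := by
  obtain ⟨f, hf⟩ := hG P E (π.comp ρ) ε hε
  refine ⟨f.comp s, MonoidHom.ext fun b => ?_⟩
  have := DFunLike.congr_fun hf (s b)
  simpa [hρs] using this

/-- The lifting property is transported along isomorphisms. [folklore] -/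
theorem lift_of_mulEquiv {B : Type u} {B' : Type v} [Group B] [Group B'] (e : B ≃* B')
    (hB : ∀ (P E : Type) [Group P] [Finite P] [Group E] [Finite E] (π : B →* P) (ε : E →* P),
      Function.Surjective ε → ∃ f : B →* E, ε.comp f = π)
    (P E : Type) [Group P] [Finite P] [Group E] [Finite E] (π : B' →* P) (ε : E →* P)
    (hε : Function.Surjective ε) : ∃ f : B' →* E, ε.comp f = π := by
  obtain ⟨f, hf⟩ := hB P E (π.comp e.toMonoidHom) ε hε
  refine ⟨f.comp e.symm.toMonoidHom, MonoidHom.ext fun x => ?_⟩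
  have := DFunLike.congr_fun hf (e.symm x)
  simpa using this

/-! ## The sieve on one closed 3-manifold: lifting property ⟹ free fundamental group -/

/-- **A closed orientable 3-manifold group with the lifting property is free** — CONDITIONAL on
the named facts F1 (`kneserMilnor_retract_alternative`) and F2
(`not_lift_fundamentalGroup_of_aspherical`).  By F1, either `π₁(Y, y)` is free of some rank, or
it retracts onto a non-trivial `B` which inherits the lifting property (`lift_of_retract`) and is
finite — impossible, `subsingleton_of_finite_of_lift` — or isomorphic to a closed orientable
aspherical 3-manifold group — impossible by F2 (`lift_of_mulEquiv`).  (The finite-level content of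
Wilton–Zalesskii (2019), Cor. 1.13 applied to `π̂₁Y` projective: no finite and no aspherical
Kneser–Milnor summand.) -/
theorem exists_isFreeOfRank_fundamentalGroup_of_lift_of_facts
    (h₁ : kneserMilnor_retract_alternative.{u}) (h₂ : not_lift_fundamentalGroup_of_aspherical.{u})
    (Y : Type u) [TopologicalSpace Y] [T2Space Y] [SecondCountableTopology Y]
    [ChartedSpace (EuclideanSpace ℝ (Fin 3)) Y] [IsManifold (𝓡 3) ∞ Y] [CompactSpace Y]
    [ConnectedSpace Y] (hY : IsOrientable (𝓡 3) Y) (y : Y)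
    (hlift : ∀ (P E : Type) [Group P] [Finite P] [Group E] [Finite E]
      (π : FundamentalGroup Y y →* P) (ε : E →* P), Function.Surjective ε →
      ∃ f : FundamentalGroup Y y →* E, ε.comp f = π) :
    ∃ r : ℕ, IsFreeOfRank (FundamentalGroup Y y) r := by
  rcases h₁ Y hY y with hfree | ⟨B, _, hB, hkind, ρ, s, hρs⟩
  · exact hfree
  · exfalso
    have hBlift := lift_of_retract ρ s hρs hlift
    rcases hkind with hfin | ⟨Z, _, _, _, _, _, _, _, hZ, z, hasph, ⟨eB⟩⟩
    · haveI := hfin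
      haveI := subsingleton_of_finite_of_lift hBlift
      exact not_nontrivial B hB
    · exact h₂ Z hZ z hasph (lift_of_mulEquiv eB hBlift)

/-- **Wilton–Zalesskii's Theorem A for `#ᵏ(S¹ × S²)`, on fundamental groups, from F1 and F2**:
the tree's apex named fact `isFreeOfRank_fundamentalGroup_of_sameFiniteQuotients` (a closed
orientable 3-manifold group with exactly the finite quotients of `F_k` is free of rank `k`) FOLLOWS
from Kneser–Milnor in retract form and the non-lifting of closed aspherical 3-manifold groups —
without profinite completions, Dixon–Formanek–Poland–Ribes or profinite Bass–Serre theory: "same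
finite quotients as `F_k`" gives the lifting property
(`exists_monoidHom_comp_eq_of_sameFiniteQuotients_freeGroup`), hence freeness of some rank
(`exists_isFreeOfRank_fundamentalGroup_of_lift_of_facts`), and rank detection
(`IsFreeOfRank.of_sameFiniteQuotients`) pins the rank.  So the route's old fact debt is dominated
by the new one. -/
theorem isFreeOfRank_fundamentalGroup_of_sameFiniteQuotients_of_facts
    (h₁ : kneserMilnor_retract_alternative.{u}) (h₂ : not_lift_fundamentalGroup_of_aspherical.{u}) :
    isFreeOfRank_fundamentalGroup_of_sameFiniteQuotients.{u} := by
  intro k Y _ _ _ _ _ _ _ hY y hQ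
  obtain ⟨r, hr⟩ := exists_isFreeOfRank_fundamentalGroup_of_lift_of_facts h₁ h₂ Y hY y
    fun P E _ _ _ _ π ε hε => exists_monoidHom_comp_eq_of_sameFiniteQuotients_freeGroup hQ π ε hε
  exact hr.of_sameFiniteQuotients hQ

/-! ## The crux under the named facts -/

/-- **Profinite detection of freeness for Heegaard-pair quotients, by the projective-retract sieve —
CONDITIONAL on three named facts**: F1 (Kneser–Milnor in retract form), F2 (closed aspherical
3-manifold groups lack the lifting property) and the Jaco–Hempel bridge
`exists_closedThreeManifold_fundamentalGroup_pairQuotient` (the pair quotient is a closed orientable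
3-manifold group).  Proof: the tree's corollary `isFreeOfRank_pairQuotient_of_sameFiniteQuotients`
with its Wilton–Zalesskii hypothesis supplied by
`isFreeOfRank_fundamentalGroup_of_sameFiniteQuotients_of_facts`. -/
theorem HeegaardPairFreenessDetection_of_facts
    (h₁ : kneserMilnor_retract_alternative.{0})
    (h₂ : not_lift_fundamentalGroup_of_aspherical.{0})
    (h₃ : exists_closedThreeManifold_fundamentalGroup_pairQuotient.{0}) :
    Summit.SmoothPoincare4.SmoothPoincare4.Theses.CongruenceShadows.HeegaardPairFreenessDetection :=
  fun g k K₁ K₂ hK₁ hK₂ hQ =>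
    isFreeOfRank_pairQuotient_of_sameFiniteQuotients
      (isFreeOfRank_fundamentalGroup_of_sameFiniteQuotients_of_facts h₁ h₂) h₃ g k K₁ K₂ hK₁ hK₂ hQ

/-- **The crux CONDITIONAL on F1, F2 and Jaco's realisation lemma**
`exists_heegaardSplitting_realizing_kernels` (Hempel Lemma 14.5 = Jaco 1969), the finest existing
named fact on the bridge side: the tree proves the bridge from it
(`exists_closedThreeManifold_fundamentalGroup_pairQuotient_of_realization`, van Kampen +
stabilisation).  These three hypotheses are exactly the three registered fact stubs of the line's
skeleton (`Cruxes/HeegaardPairFreenessDetection/Lines/Sketch.lean`). -/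
theorem HeegaardPairFreenessDetection_of_facts'
    (h₁ : kneserMilnor_retract_alternative.{0})
    (h₂ : not_lift_fundamentalGroup_of_aspherical.{0})
    (h₃ : exists_heegaardSplitting_realizing_kernels.{0}) :
    Summit.SmoothPoincare4.SmoothPoincare4.Theses.CongruenceShadows.HeegaardPairFreenessDetection :=
  HeegaardPairFreenessDetection_of_facts h₁ h₂
    (exists_closedThreeManifold_fundamentalGroup_pairQuotient_of_realization h₃)

end Summit.SmoothPoincare4.SmoothPoincare4.Theorems.HeegaardPairFreenessDetection.Sieve

end
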